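import Mathlib
import HarnessLib
import Literature.MathematicalPhysics.StatisticalMechanics.StepKernelBoundsDominatedABKM
import Literature.MathematicalPhysics.StatisticalMechanics.TorusFRDStepKernelMultipliers
import Literature.MathematicalPhysics.StatisticalMechanics.WeightTheoremABKM

/-!
# `StepKernelBounds` for the `q`-dependent step kernels of the torus decomposition relative to the
# `q = 0` weights ([ABKM19] Lemma 7.7 for `q ∈ B_κ`, fully instantiated)

The glue promised by `StepKernelBoundsABKM` / `StepKernelBoundsDominatedABKM` (bookkeeping) and
`TorusFRDStepKernelMultipliers` (the multiplier comparison (7.75) from the decomposition): for ONE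
finite-range-decomposition package at fixed `L, N, M` (clauses (o)–(v) of `GradientFRD.TorusFRD d` for
every `A ∈ 𝓛(½,2)`, as delivered by `TorusFRD_holds d`), the weights built from the `A = 1` kernels
(`AbkmWeightBounds`, e.g. by `WeightTheoremABKMPackage.abkm_weight_bounds_of_package`) and a tuning
parameter `q = T·B` (`B` unit symmetric, `0 ≤ T ≤ ½`, `K T ≤ log (1+ρ)` with
`K = shellRatioConst c (Cℓ 1) L d ñ`, `0 ≤ ρ < θ̄`), the step kernel `𝒞_{1+q,k+1}` satisfies

* **`stepKernelBounds_of_torusFRD`** — `StepKernelBounds W L k A𝒫(ρ) (secondDiffConst C) (𝒞_{1+q,k+1})`,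
  `A𝒫(ρ) = weightIntConstRho θ̄ ρ (traceConst d M_ord R λ (derivSum d n C))`, `C θ' = Cα θ' 0` the
  `A`-uniform regularity constants of clause (iv);

so that `RGStepABKMQ.isRGStepQ_abkm_of_stepKernelBounds` gives [ABKM19] Theorem 6.8 for the maps
`T_k^{(q)}` in the norms of the `q = 0` weights, uniformly in `q ∈ B_κ`, `κ = log(1+ρ)/K`.
Everything is proved; no named fact.

## References
* S. Adams, S. Buchholz, R. Kotecký, S. Müller, arXiv:1910.13564, Lemma 7.7, Theorem 6.8, Ch. 12
  [AdamsBuchholzKoteckyMuller2019].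
* S. Buchholz, J. Funct. Anal. 275 (2018), Thm 2.4 [Buchholz2016].
-/

noncomputable section

namespace Literature.MathematicalPhysics.StatisticalMechanics.GradientRG

open Real Set Finset
open Literature.MathematicalPhysics.StatisticalMechanics.GradientFRD
  (fourierCoeff cExt cExt_of_mem IsElliptic IsUnitSymm InShell iterDiff supNorm conv ellOp isElliptic_one)

variable {d M : ℕ} [NeZero M]

/-- **`StepKernelBounds` for `𝒞_{1+q,k+1}` relative to the `q = 0` weights** (module docstring).
[cite: AdamsBuchholzKoteckyMuller2019, Lemma 7.7] -/
theorem stepKernelBounds_of_torusFRD {L N Mord R n ñ : ℕ} {θbar lam μ δ₁ δ₀ A𝒫 : ℝ}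
    {𝒞 : Matrix (Fin d) (Fin d) ℝ → ℕ → (Fin d → ZMod M) → ℝ} {Mc : ℕ → ℝ}
    {Cα : (Fin d → ℕ) → ℕ → ℝ} {c C : ℝ} {Cℓ : ℕ → ℝ}
    (hd : 3 ≤ d) (hMord : 1 ≤ Mord) (hMR : Mord ≤ R) (hLodd : Odd L) (hL : 2 ^ (d + 3) + 16 * R ≤ L)
    (hθbar : 0 < θbar) (hlam : 0 < lam) (hn : 2 * Mord ≤ n) (hn2 : 2 ≤ n) (hnñ : n ≤ ñ)
    (hc : 0 < c) (hC1 : 0 ≤ Cℓ 1)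
    (hallA : ∀ A : Matrix (Fin d) (Fin d) ℝ, IsElliptic (1 / 2 : ℝ) 2 A →
        (∀ k, 1 ≤ k → k ≤ N + 1 →
          ∑ x : Fin d → ZMod M, 𝒞 A k x = 0 ∧ ∀ x, 𝒞 A k (-x) = 𝒞 A k x) ∧
        (∀ k, 1 ≤ k → k ≤ N + 1 → ∀ φ : (Fin d → ZMod M) → ℝ, ∑ x, φ x = 0 →
          0 ≤ ∑ x, ∑ y, φ x * 𝒞 A k (x - y) * φ y) ∧
        (∀ φ : (Fin d → ZMod M) → ℝ, ∑ x, φ x = 0 →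
          ellOp A (conv (fun x => ∑ k ∈ Finset.Icc 1 (N + 1), 𝒞 A k x) φ) = φ) ∧
        (∀ k, 1 ≤ k → k ≤ N → Mc k ≤ 0 ∧
          ∀ x : Fin d → ZMod M, ((L : ℝ) ^ k) / 2 ≤ (supNorm x : ℝ) →
            𝒞 A k x = Mc k) ∧
        (∀ k, 1 ≤ k → k ≤ N + 1 → ∀ B : Matrix (Fin d) (Fin d) ℝ, IsUnitSymm B →
          (∃ ε : ℝ, 0 < ε ∧ ∀ x : Fin d → ZMod M,
            ContDiffOn ℝ ⊤ (fun s : ℝ => 𝒞 (A + s • B) k x) (Set.Ioo (-ε) ε)) ∧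
          ∀ α : Fin d → ℕ, ∑ i, α i ≤ n → ∀ ℓ : ℕ, ∀ x : Fin d → ZMod M,
            abs (iteratedDeriv ℓ (fun s : ℝ => iterDiff α (𝒞 (A + s • B) k) x) 0)
              ≤ Cα α ℓ / (L : ℝ) ^ ((k - 1) * (d - 2 + ∑ i, α i))) ∧
        (∀ k, 1 ≤ k → k ≤ N + 1 → ∀ j : ℕ, ∀ κ : Fin d → ZMod M, κ ≠ 0 → InShell L j κ →
          (j < k →
            c / (L : ℝ) ^ (2 * (d + ñ) + 1) * (L : ℝ) ^ (2 * j)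
                / (L : ℝ) ^ ((k - j) * (d - 1 + n)) ≤ (fourierCoeff (𝒞 A k) κ).re ∧
            ‖fourierCoeff (𝒞 A k) κ‖
              ≤ C * (L : ℝ) ^ (2 * (d + ñ) + 1) * (L : ℝ) ^ (2 * j)
                  / (L : ℝ) ^ ((k - j) * (d - 1 + n))) ∧
          (k ≤ j →
            c / (L : ℝ) ^ (2 * (d + ñ) + 1) * (L : ℝ) ^ (2 * k)
                ≤ (fourierCoeff (𝒞 A k) κ).re ∧
            ‖fourierCoeff (𝒞 A k) κ‖ ≤ C * (L : ℝ) ^ (2 * k)) ∧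
          ∀ B : Matrix (Fin d) (Fin d) ℝ, IsUnitSymm B → ∀ ℓ : ℕ, 1 ≤ ℓ →
            (j < k →
              ‖iteratedDeriv ℓ (fun s : ℝ => fourierCoeff (𝒞 (A + s • B) k) κ) 0‖
                ≤ Cℓ ℓ * (L : ℝ) ^ (2 * (d + ñ) + 1) * (L : ℝ) ^ (2 * j)
                    / (L : ℝ) ^ ((k - j) * (d - 1 + ñ))) ∧
            (k ≤ j →
              ‖iteratedDeriv ℓ (fun s : ℝ => fourierCoeff (𝒞 (A + s • B) k) κ) 0‖
                ≤ Cℓ ℓ * (L : ℝ) ^ (2 * k))))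
    (hB : AbkmWeightBounds L N Mord R n θbar lam μ δ₁ δ₀ A𝒫 (fun j => 𝒞 1 j)
      (abkmWeightData L N Mord R θbar (schedDelta δ₀ δ₁ N) fun j => 𝒞 1 j))
    {k : ℕ} (hk : k + 1 ≤ N + 1) {ρ : ℝ} (hρ0 : 0 ≤ ρ) (hρ : ρ < θbar)
    {B : Matrix (Fin d) (Fin d) ℝ} (hBu : IsUnitSymm B) {T : ℝ} (hT0 : 0 ≤ T) (hT : T ≤ 1 / 2)
    (hKT : shellRatioConst c (Cℓ 1) (L : ℝ) d ñ * T ≤ Real.log (1 + ρ)) :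
    StepKernelBounds (abkmWeightData L N Mord R θbar (schedDelta δ₀ δ₁ N) fun j => 𝒞 1 j) L k
      (weightIntConstRho θbar ρ (traceConst d Mord R lam (derivSum d n fun θ' _ => Cα θ' 0)))
      (secondDiffConst fun θ' => Cα θ' 0) (𝒞 ((1 : Matrix (Fin d) (Fin d) ℝ) + T • B) (k + 1)) := by
  have h8 : 8 ≤ 2 ^ (d + 3) := by
    calc 8 = 2 ^ 3 := by norm_num
      _ ≤ 2 ^ (d + 3) := Nat.pow_le_pow_right (by norm_num) (by omega)
  have hL2 : 2 ≤ L := by omega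
  have hL1 : 1 ≤ L := by omega
  have hd2 : 2 ≤ d := by omega
  set A' : Matrix (Fin d) (Fin d) ℝ := 1 + T • B with hA'
  have hellA' : IsElliptic (1 / 2 : ℝ) 2 A' := isElliptic_one_add_smul hBu hT0 hT
  -- the clauses at `A = 1 + T•B`
  have hq := hallA A' hellA'
  -- regularity (clause (iv), `ℓ = 0`) of both families, with the SAME constants
  have hreg : ∀ A : Matrix (Fin d) (Fin d) ℝ, IsElliptic (1 / 2 : ℝ) 2 A →
      ∀ j, 1 ≤ j → j ≤ N + 1 → ∀ θ' : Fin d → ℕ, ∑ i, θ' i ≤ n → ∀ x,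
        |iterDiff θ' (𝒞 A j) x| ≤ Cα θ' 0 / (L : ℝ) ^ ((j - 1) * (d - 2 + ∑ i, θ' i)) := by
    intro A hA j hj1 hjN θ' hθ' x
    obtain ⟨-, hb⟩ := (hallA A hA).2.2.2.2.1 j hj1 hjN 0 isUnitSymm_zero
    have := hb θ' hθ' 0 x
    rw [iteratedDeriv_zero] at this
    simpa only [smul_zero, add_zero] using this
  -- the multiplier hypotheses
  have hqeven : ∀ x, 𝒞 A' (k + 1) (-x) = 𝒞 A' (k + 1) x := (hq.1 (k + 1) (by omega) hk).2
  have hq_nonneg : ∀ κ, 0 ≤ (fourierCoeff (𝒞 A' (k + 1)) κ).re := fun κ =>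
    re_fourierCoeff_nonneg_of_torusFRD hq.1 hq.2.2.2.2.2 hc hL2 (by omega) hk κ
  have hq_le : ∀ κ, (fourierCoeff (𝒞 A' (k + 1)) κ).re ≤
      (1 + ρ) * cExt N (fun j => fourierCoeff (𝒞 1 j) κ) (k + 1) := by
    intro κ
    rw [cExt_of_mem (f := fun j => fourierCoeff (𝒞 1 j) κ) (by omega) hk]
    exact re_fourierCoeff_one_add_smul_le (fun A hA => (hallA A hA).1) (fun A hA => (hallA A hA).2.2.2.2.1)
      (fun A hA => (hallA A hA).2.2.2.2.2) hc hC1 hL2 hnñ hBu hT0 hT (by omega) hk hρ0 hKT κ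
  have hγ : ∀ q : quadIndex d,
      ((L ^ (d * k) : ℕ) : ℝ) * |gradCov (𝒞 A' (k + 1)) q| ≤ secondDiffConst fun θ' => Cα θ' 0 :=
    fun q => abs_gradCov_abkm_le (𝒞 := fun j => 𝒞 A' j) hd2 hn2 hL1 (hreg A' hellA') hk q
  exact AbkmWeightBounds.stepKernelBounds_of_multipliers_le hd2 hMord hMR hLodd hL hθbar hlam hB hn
    (hreg 1 isElliptic_one) hk hρ0 hρ hqeven hq_nonneg hq_le hγ

end Literature.MathematicalPhysics.StatisticalMechanics.GradientRG

end
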